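import Mathlib.GroupTheory.Index
import Mathlib.GroupTheory.SpecificGroups.Cyclic
import Mathlib.Data.Int.CardIntervalMod
import Mathlib.Data.Fintype.BigOperators
import Mathlib.Algebra.BigOperators.Field
import Mathlib.Data.Set.Card
import Mathlib.Algebra.Group.Fin.Tuple
import Mathlib.Analysis.SpecialFunctions.Log.Basic
import Mathlib.Tactic.Positivity
import Mathlib.Tactic.FieldSimp
import Mathlib.Tactic.Ring
import Mathlib.Tactic.Linarith
import Mathlib.Tactic.GCongr
import HarnessLib

/-!
# Lattice cosets in a box: Lenstra–Pomerance 1992, Lemma 5.1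

H. W. Lenstra Jr. and C. Pomerance, *A rigorous time bound for factoring integers*,
J. Amer. Math. Soc. **5** (1992) 483–516, §5 "Random forms", **Lemma 5.1** (pp. 497–498), whose
proof rests on A. K. Lenstra, *Fast and rigorous factorization under the generalized Riemann
hypothesis*, Indag. Math. **50** (1988) 443–454, Lemma (4.1):

> Let `m, h, d, b` be positive integers with `d ≤ b`, and `Λ ⊂ ℤ^m` a subgroup of index `h` with
> `(dℤ)^m ⊂ Λ`. Further let `𝒞 ⊂ ℤ^m` be a coset of `Λ`. Then
> `#({1, 2, …, b}^m ∩ 𝒞) = (b^m / h) · exp ε` for some real number `ε` satisfying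
> `|ε| ≤ min{h - 1, m(d - 1)} / (b - d + 1)`.

This is `coset_box_count_eq_exp`. The heart is the product estimate of A. K. Lenstra
(`exists_diag_box_count_bounds`): there are positive integers `h₁, …, h_m` dividing `d` with
`∏ hᵢ = h` and `∏ (1 - (hᵢ-1)/b) ≤ (h/b^m) · #({1,…,b}^m ∩ 𝒞) ≤ ∏ (1 + (hᵢ-1)/b)`, proved here
by induction on `m` along the first coordinate (`index_eq_index_map_mul_index_comap`:
`[ℤ^m : Λ] = [ℤ : π(Λ)] · [ℤ^{m-1} : Λ']`; the slices of `𝒞` are cosets of `Λ'`; an arithmetic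
progression of difference `h₁ ≤ b` meets `{1,…,b}` in `N` points, `b-h₁+1 ≤ h₁N ≤ b+h₁-1`,
`card_Icc_filter_dvd_sub_bounds`), followed by the paper's `log(1+x) ≤ x`,
`|log(1-x)| ≤ x/(1-x)` step. Conventions: `ℤ^m = Fin m → ℤ`, `(dℤ)^m ⊂ Λ` is `d·eᵢ ∈ Λ` for all
`i`, the coset is `{x : x - c ∈ Λ}`, `h = Λ.index`; `m = 0` is allowed (trivially true).
Everything is proved; no definitions, no named facts.
-/

namespace Literature.Algebra.EuclideanLattices
namespace LenstraPomerance

open Finset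

/-- Counting an arithmetic progression in `{1, …, b}`: for `0 < h` and any `c₀`, the number
`N` of `t ∈ {1, …, b}` with `h ∣ t - c₀` satisfies `b - h + 1 ≤ h N ≤ b + h - 1`. [folklore] -/
theorem card_Icc_filter_dvd_sub_bounds (b : ℕ) {h : ℤ} (hh : 0 < h) (c₀ : ℤ) :
    (b : ℤ) - h + 1 ≤ h * #{t ∈ Icc (1 : ℤ) b | h ∣ t - c₀} ∧
      h * #{t ∈ Icc (1 : ℤ) b | h ∣ t - c₀} ≤ (b : ℤ) + h - 1 := by
  have hIcc : Icc (1 : ℤ) b = Ioc (0 : ℤ) b := by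
    ext t; simp only [mem_Icc, mem_Ioc]; omega
  have hfilter : #{t ∈ Icc (1 : ℤ) b | h ∣ t - c₀} = #{t ∈ Ioc (0 : ℤ) b | t ≡ c₀ [ZMOD h]} := by
    rw [hIcc]
    congr 1
    refine filter_congr fun t _ => ?_
    exact ⟨fun hd => (Int.modEq_iff_dvd.2 hd).symm, fun hm => Int.modEq_iff_dvd.1 hm.symm⟩
  have hcard := Int.Ioc_filter_modEq_card 0 b hh c₀
  rw [← hfilter] at hcard
  set N : ℕ := #{t ∈ Icc (1 : ℤ) b | h ∣ t - c₀} with hN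
  set A : ℤ := ⌊(((b : ℤ) : ℚ) - c₀) / h⌋ with hA
  set B : ℤ := ⌊(((0 : ℤ) : ℚ) - c₀) / h⌋ with hB
  have hhq : (0 : ℚ) < h := by exact_mod_cast hh
  have hA1 : ((A : ℚ)) ≤ (((b : ℤ) : ℚ) - c₀) / h := Int.floor_le _
  have hA2 : (((b : ℤ) : ℚ) - c₀) / h < A + 1 := Int.lt_floor_add_one _
  have hB1 : ((B : ℚ)) ≤ (((0 : ℤ) : ℚ) - c₀) / h := Int.floor_le _
  have hB2 : (((0 : ℤ) : ℚ) - c₀) / h < B + 1 := Int.lt_floor_add_one _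
  rw [le_div_iff₀ hhq] at hA1 hB1
  rw [div_lt_iff₀ hhq] at hA2 hB2
  have hAB : B ≤ A := Int.floor_le_floor (by
    apply div_le_div_of_nonneg_right _ hhq.le
    push_cast; linarith)
  have hmax : max (A - B) 0 = A - B := max_eq_left (by linarith)
  rw [hmax] at hcard
  -- hcard : (N : ℤ) = A - B
  have hlow : ((b : ℤ) : ℚ) - h < h * (A - B) := by push_cast at hA2 hB1 ⊢; nlinarith
  have hupp : (h : ℚ) * (A - B) < ((b : ℤ) : ℚ) + h := by push_cast at hA1 hB2 ⊢; nlinarith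
  have hlow' : (b : ℤ) - h < h * (A - B) := by exact_mod_cast hlow
  have hupp' : h * (A - B) < (b : ℤ) + h := by exact_mod_cast hupp
  rw [← hcard] at hlow' hupp'
  constructor <;> omega

/-! ### The first coordinate and the remaining ones -/

/-- `Fin.cons 0 : ℤ^m → ℤ^{m+1}` is additive. [folklore] -/
theorem cons_zero_add {m : ℕ} (x y : Fin m → ℤ) :
    (Fin.cons 0 (x + y) : Fin (m + 1) → ℤ) = (Fin.cons 0 x : Fin (m + 1) → ℤ) + Fin.cons 0 y := by
  funext i
  refine Fin.cases ?_ (fun j => ?_) i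
  · simp
  · simp

/-- The kernel of the first-coordinate projection `ℤ^{m+1} → ℤ` is the image of
`Fin.cons 0 : ℤ^m → ℤ^{m+1}`. [folklore] -/
theorem ker_eval_zero_eq_range {m : ℕ} (ψ : (Fin m → ℤ) →+ (Fin (m + 1) → ℤ))
    (hψ : ∀ x, ψ x = Fin.cons 0 x) :
    (Pi.evalAddMonoidHom (fun _ : Fin (m + 1) => ℤ) 0).ker = ψ.range := by
  ext x
  rw [AddMonoidHom.mem_ker, AddMonoidHom.mem_range, Pi.evalAddMonoidHom_apply]
  constructor
  · intro hx
    refine ⟨Fin.tail x, ?_⟩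
    rw [hψ, ← hx]
    exact Fin.cons_self_tail x
  · rintro ⟨y, rfl⟩
    rw [hψ]
    rfl

/-- **Index along the first coordinate.** For a subgroup `Λ ≤ ℤ^{m+1}`:
`[ℤ^{m+1} : Λ] = [ℤ : π(Λ)] · [ℤ^m : Λ']`, where `π` is the first-coordinate projection and
`Λ' = {x' : Fin.cons 0 x' ∈ Λ}`. [folklore] -/
theorem index_eq_index_map_mul_index_comap {m : ℕ} (Λ : AddSubgroup (Fin (m + 1) → ℤ))
    (ψ : (Fin m → ℤ) →+ (Fin (m + 1) → ℤ)) (hψ : ∀ x, ψ x = Fin.cons 0 x) :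
    Λ.index = (Λ.map (Pi.evalAddMonoidHom (fun _ : Fin (m + 1) => ℤ) 0)).index
      * (Λ.comap ψ).index := by
  set φ := Pi.evalAddMonoidHom (fun _ : Fin (m + 1) => ℤ) 0 with hφ
  have hφsurj : Function.Surjective φ := fun t => ⟨Fin.cons t 0, by simp [hφ]⟩
  have hker : φ.ker = ψ.range := ker_eval_zero_eq_range ψ hψ
  have h1 : Λ.relIndex (Λ ⊔ φ.ker) * (Λ ⊔ φ.ker).index = Λ.index :=
    AddSubgroup.relIndex_mul_index le_sup_left
  have h2 : (Λ ⊔ φ.ker).index = (Λ.map φ).index := by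
    rw [← AddSubgroup.comap_map_eq, AddSubgroup.index_comap_of_surjective _ hφsurj]
  have h3 : Λ.relIndex (Λ ⊔ φ.ker) = Λ.relIndex φ.ker := AddSubgroup.relIndex_sup_left _ _
  have h4 : Λ.relIndex φ.ker = (Λ.comap ψ).index := by
    rw [hker, ← AddSubgroup.relIndex_top_right, AddSubgroup.relIndex_comap,
      AddMonoidHom.range_eq_map]
  rw [← h1, h3, h4, h2, mul_comm]

/-- **Counting in a box along the first coordinate.** [folklore] -/
theorem card_box_filter_succ {m : ℕ} (Λ : AddSubgroup (Fin (m + 1) → ℤ))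
    [DecidablePred (· ∈ Λ)] (b : ℕ) (c : Fin (m + 1) → ℤ) :
    #{x ∈ Fintype.piFinset (fun _ : Fin (m + 1) => Icc (1 : ℤ) b) | x - c ∈ Λ}
      = ∑ t ∈ Icc (1 : ℤ) b, #{x' ∈ Fintype.piFinset (fun _ : Fin m => Icc (1 : ℤ) b) |
          (Fin.cons t x' : Fin (m + 1) → ℤ) - c ∈ Λ} := by
  rw [← card_sigma]
  refine card_bij' (fun x _ => ⟨x 0, Fin.tail x⟩) (fun p _ => Fin.cons p.1 p.2) ?_ ?_ ?_ ?_
  · intro x hx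
    rw [mem_filter, Fintype.mem_piFinset] at hx
    rw [mem_sigma, mem_filter, Fintype.mem_piFinset, Fin.cons_self_tail]
    exact ⟨hx.1 0, fun i => hx.1 i.succ, hx.2⟩
  · rintro ⟨t, x'⟩ hp
    rw [mem_sigma, mem_filter, Fintype.mem_piFinset] at hp
    rw [mem_filter, Fintype.mem_piFinset]
    refine ⟨fun i => Fin.cases ?_ (fun j => ?_) i, hp.2.2⟩
    · simpa using hp.1
    · simpa using hp.2.1 j
  · intro x _
    exact Fin.cons_self_tail x
  · rintro ⟨t, x'⟩ _
    simp

/-! ### The theorem of A. K. Lenstra (product form) -/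

/-- **A. K. Lenstra's lemma (LP92 (5.1), proof): product bounds.** Let `Λ ≤ ℤ^m` be a subgroup
containing `(dℤ)^m` (`d ≥ 1`). Then there are positive integers `h₁, …, h_m` dividing `d` with
`∏ hᵢ = [ℤ^m : Λ]` such that for every `b ≥ d` and every coset `c + Λ`,
`∏ (b - hᵢ + 1)/hᵢ ≤ #({1,…,b}^m ∩ (c + Λ)) ≤ ∏ (b + hᵢ - 1)/hᵢ`.
(Induction on `m` along the first coordinate: `h₁ = [ℤ : π(Λ)]`, the slices are cosets of
`Λ' = {x' : (0, x') ∈ Λ}` in `ℤ^{m-1}`, and an arithmetic progression of difference `h₁` meets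
`{1,…,b}` in `N` points with `b - h₁ + 1 ≤ h₁ N ≤ b + h₁ - 1`.)
[cite: LenstraPomerance1992, Lemma 5.1 (proof, p. 498)] -/
theorem exists_diag_box_count_bounds :
    ∀ (m : ℕ) (Λ : AddSubgroup (Fin m → ℤ)) (d : ℕ), 0 < d →
      (∀ i, Pi.single i (d : ℤ) ∈ Λ) →
      ∃ hs : Fin m → ℕ, (∀ i, 0 < hs i ∧ hs i ∣ d) ∧ Λ.index = ∏ i, hs i ∧
        ∀ (b : ℕ) (c : Fin m → ℤ), d ≤ b →
          (∏ i, ((b : ℝ) - hs i + 1) / hs i)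
              ≤ ({x : Fin m → ℤ | (∀ i, 1 ≤ x i ∧ x i ≤ (b : ℤ)) ∧ x - c ∈ Λ}.ncard : ℝ) ∧
          ({x : Fin m → ℤ | (∀ i, 1 ≤ x i ∧ x i ≤ (b : ℤ)) ∧ x - c ∈ Λ}.ncard : ℝ)
              ≤ ∏ i, ((b : ℝ) + hs i - 1) / hs i
  | 0, Λ, d, _, _ => by
      refine ⟨fun i => i.elim0, fun i => i.elim0, ?_, fun b c _ => ?_⟩
      · rw [Finset.univ_eq_empty, prod_empty, AddSubgroup.index_eq_one]
        exact eq_top_iff.2 fun x _ => by rw [Subsingleton.elim x 0]; exact Λ.zero_mem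
      · have hset : {x : Fin 0 → ℤ | (∀ i, 1 ≤ x i ∧ x i ≤ (b : ℤ)) ∧ x - c ∈ Λ} = Set.univ := by
          ext x
          simp only [Set.mem_setOf_eq, Set.mem_univ, iff_true]
          exact ⟨fun i => i.elim0, by rw [Subsingleton.elim (x - c) 0]; exact Λ.zero_mem⟩
        rw [hset, Set.ncard_univ, Nat.card_unique]
        simp
  | m + 1, Λ, d, hd, hdΛ => by
      classical
      set φ := Pi.evalAddMonoidHom (fun _ : Fin (m + 1) => ℤ) 0 with hφ
      let ψ : (Fin m → ℤ) →+ (Fin (m + 1) → ℤ) :=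
        AddMonoidHom.mk' (fun x => Fin.cons 0 x) cons_zero_add
      have hψ : ∀ x, ψ x = Fin.cons 0 x := fun x => rfl
      set Λ' := Λ.comap ψ with hΛ'
      -- `Λ'` contains `(dℤ)^m`
      have hdΛ' : ∀ i, Pi.single i (d : ℤ) ∈ Λ' := by
        intro i
        rw [hΛ', AddSubgroup.mem_comap, hψ]
        have : (Fin.cons 0 (Pi.single i (d : ℤ)) : Fin (m + 1) → ℤ) = Pi.single i.succ (d : ℤ) := by
          funext j
          refine Fin.cases ?_ (fun k => ?_) j
          · simp [(Fin.succ_ne_zero i).symm]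
          · simp [Pi.single_apply, Fin.succ_inj]
        rw [this]
        exact hdΛ i.succ
      obtain ⟨hs', hhs', hidx', hcount'⟩ := exists_diag_box_count_bounds m Λ' d hd hdΛ'
      -- `h₁ = [ℤ : π(Λ)]`
      obtain ⟨a, ha⟩ := Int.subgroup_cyclic (Λ.map φ)
      have hmapφ : Λ.map φ = AddSubgroup.zmultiples a := by
        rw [ha, AddSubgroup.zmultiples_eq_closure]
      have hdmem : (d : ℤ) ∈ Λ.map φ := ⟨Pi.single 0 (d : ℤ), hdΛ 0, by simp [hφ]⟩
      have had : a ∣ d := by rw [hmapφ, Int.mem_zmultiples_iff] at hdmem; exact hdmem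
      set h₁ : ℕ := a.natAbs with hh₁
      have hh₁d : h₁ ∣ d := by
        have := Int.natAbs_dvd_natAbs.2 had
        simpa [hh₁] using this
      have hh₁0 : 0 < h₁ := Nat.pos_of_dvd_of_pos hh₁d hd
      have hidx₁ : (Λ.map φ).index = h₁ := by rw [hmapφ, Int.index_zmultiples]
      refine ⟨Fin.cons h₁ hs', ?_, ?_, ?_⟩
      · intro i
        refine Fin.cases ?_ (fun j => ?_) i
        · simpa using ⟨hh₁0, hh₁d⟩
        · simpa using hhs' j
      · rw [Fin.prod_univ_succ, index_eq_index_map_mul_index_comap Λ ψ hψ, hidx₁, ← hΛ', hidx']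
        simp
      · intro b c hdb
        have hb₁ : h₁ ≤ b := (Nat.le_of_dvd hd hh₁d).trans hdb
        set box := Fintype.piFinset (fun _ : Fin (m + 1) => Icc (1 : ℤ) b) with hbox
        set box' := Fintype.piFinset (fun _ : Fin m => Icc (1 : ℤ) b) with hbox'
        have hS : {x : Fin (m + 1) → ℤ | (∀ i, 1 ≤ x i ∧ x i ≤ (b : ℤ)) ∧ x - c ∈ Λ}
            = ↑(box.filter fun x => x - c ∈ Λ) := by
          ext x; simp [hbox, Fintype.mem_piFinset]
        have hS' : ∀ c' : Fin m → ℤ, {x : Fin m → ℤ | (∀ i, 1 ≤ x i ∧ x i ≤ (b : ℤ)) ∧ x - c' ∈ Λ'}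
            = ↑(box'.filter fun x => x - c' ∈ Λ') := by
          intro c'; ext x; simp [hbox', Fintype.mem_piFinset]
        rw [hS, Set.ncard_coe_finset]
        have hIH : ∀ c' : Fin m → ℤ,
            (∏ i, ((b : ℝ) - hs' i + 1) / hs' i) ≤ #(box'.filter fun x => x - c' ∈ Λ') ∧
            (#(box'.filter fun x => x - c' ∈ Λ') : ℝ) ≤ ∏ i, ((b : ℝ) + hs' i - 1) / hs' i := by
          intro c'
          have := hcount' b c' hdb
          rw [hS' c', Set.ncard_coe_finset] at this
          exact this
        rw [hbox, card_box_filter_succ Λ b c]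
        set T := (Icc (1 : ℤ) b).filter (fun t => (h₁ : ℤ) ∣ t - c 0) with hT
        -- fibres outside `T` are empty
        have hfib_out : ∀ t ∈ Icc (1 : ℤ) b, t ∉ T →
            #{x' ∈ box' | (Fin.cons t x' : Fin (m + 1) → ℤ) - c ∈ Λ} = 0 := by
          intro t ht htT
          rw [card_eq_zero, filter_eq_empty_iff]
          intro x' _ hx
          apply htT
          rw [hT, mem_filter]
          refine ⟨ht, ?_⟩
          have hmem : φ ((Fin.cons t x' : Fin (m + 1) → ℤ) - c) ∈ Λ.map φ :=
            AddSubgroup.mem_map_of_mem φ hx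
          rw [hmapφ, Int.mem_zmultiples_iff] at hmem
          have hval : φ ((Fin.cons t x' : Fin (m + 1) → ℤ) - c) = t - c 0 := by simp [hφ]
          rw [hval] at hmem
          exact Int.natAbs_dvd.2 hmem
        -- fibres inside `T` are box-counts of cosets of `Λ'`
        have hfib_in : ∀ t ∈ T, ∃ c' : Fin m → ℤ,
            (box'.filter fun x' => (Fin.cons t x' : Fin (m + 1) → ℤ) - c ∈ Λ)
              = box'.filter fun x' => x' - c' ∈ Λ' := by
          intro t ht
          rw [hT, mem_filter] at ht
          have hmem : t - c 0 ∈ Λ.map φ := by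
            rw [hmapφ, Int.mem_zmultiples_iff]; exact Int.natAbs_dvd.1 ht.2
          obtain ⟨lam, hlam, hlam0⟩ := AddSubgroup.mem_map.1 hmem
          have hlam0' : lam 0 = t - c 0 := by simpa [hφ] using hlam0
          refine ⟨Fin.tail (c + lam), filter_congr fun x' _ => ?_⟩
          have key : (Fin.cons t x' : Fin (m + 1) → ℤ) - c = ψ (x' - Fin.tail (c + lam)) + lam := by
            rw [hψ]
            funext j
            refine Fin.cases ?_ (fun k => ?_) j
            · simp [hlam0']
            · simp only [Pi.sub_apply, Pi.add_apply, Fin.cons_succ, Fin.tail]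
              ring
          rw [key, AddSubgroup.add_mem_cancel_right _ hlam, hΛ', AddSubgroup.mem_comap]
        have hsum : ∑ t ∈ Icc (1 : ℤ) b, #{x' ∈ box' | (Fin.cons t x' : Fin (m + 1) → ℤ) - c ∈ Λ}
            = ∑ t ∈ T, #{x' ∈ box' | (Fin.cons t x' : Fin (m + 1) → ℤ) - c ∈ Λ} :=
          (sum_subset (by rw [hT]; exact filter_subset _ _) hfib_out).symm
        obtain ⟨hTlow, hTupp⟩ :=
          card_Icc_filter_dvd_sub_bounds b (h := (h₁ : ℤ)) (by exact_mod_cast hh₁0) (c 0)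
        rw [← hT] at hTlow hTupp
        set P₁ := ∏ i, ((b : ℝ) - hs' i + 1) / hs' i with hP₁
        set P₂ := ∏ i, ((b : ℝ) + hs' i - 1) / hs' i with hP₂
        have hsb : ∀ i, (hs' i : ℝ) ≤ b := fun i => by
          exact_mod_cast (Nat.le_of_dvd hd (hhs' i).2).trans hdb
        have hP₁0 : 0 ≤ P₁ := prod_nonneg fun i _ =>
          div_nonneg (by linarith [hsb i]) (Nat.cast_nonneg _)
        have hP₂0 : 0 ≤ P₂ := prod_nonneg fun i _ =>
          div_nonneg (by have := (hhs' i).1; linarith [hsb i, show (1 : ℝ) ≤ hs' i by exact_mod_cast this])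
            (Nat.cast_nonneg _)
        have hlow : (#T : ℝ) * P₁
            ≤ ∑ t ∈ T, (#{x' ∈ box' | (Fin.cons t x' : Fin (m + 1) → ℤ) - c ∈ Λ} : ℝ) := by
          rw [← nsmul_eq_mul]
          refine card_nsmul_le_sum _ _ _ fun t ht => ?_
          obtain ⟨c', hc'⟩ := hfib_in t ht
          rw [hc']
          exact (hIH c').1
        have hupp : ∑ t ∈ T, (#{x' ∈ box' | (Fin.cons t x' : Fin (m + 1) → ℤ) - c ∈ Λ} : ℝ)
            ≤ #T * P₂ := by
          rw [← nsmul_eq_mul]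
          refine sum_le_card_nsmul _ _ _ fun t ht => ?_
          obtain ⟨c', hc'⟩ := hfib_in t ht
          rw [hc']
          exact (hIH c').2
        have hh₁r : (0 : ℝ) < h₁ := by exact_mod_cast hh₁0
        have hTlow' : ((b : ℝ) - h₁ + 1) / h₁ ≤ #T := by
          rw [div_le_iff₀ hh₁r]
          have : ((b : ℝ) - h₁ + 1) ≤ (h₁ : ℝ) * (#T : ℝ) := by exact_mod_cast hTlow
          linarith
        have hTupp' : (#T : ℝ) ≤ ((b : ℝ) + h₁ - 1) / h₁ := by
          rw [le_div_iff₀ hh₁r]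
          have : (h₁ : ℝ) * (#T : ℝ) ≤ ((b : ℝ) + h₁ - 1) := by exact_mod_cast hTupp
          linarith
        rw [Fin.prod_univ_succ, Fin.prod_univ_succ]
        simp only [Fin.cons_zero, Fin.cons_succ]
        rw [hsum]
        push_cast
        constructor
        · calc ((b : ℝ) - h₁ + 1) / h₁ * P₁ ≤ #T * P₁ := mul_le_mul_of_nonneg_right hTlow' hP₁0
            _ ≤ _ := hlow
        · calc _ ≤ (#T : ℝ) * P₂ := hupp
            _ ≤ ((b : ℝ) + h₁ - 1) / h₁ * P₂ := mul_le_mul_of_nonneg_right hTupp' hP₂0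

/-! ### Lemma 5.1 of Lenstra–Pomerance -/

/-- For reals `f i ≥ 1`: `∑ (f i - 1) ≤ ∏ f i - 1` (used as `∑ (hᵢ - 1) ≤ h - 1`). [folklore] -/
theorem sum_sub_one_le_prod_sub_one {ι : Type*} (s : Finset ι) (f : ι → ℝ)
    (hf : ∀ i ∈ s, 1 ≤ f i) : ∑ i ∈ s, (f i - 1) ≤ (∏ i ∈ s, f i) - 1 := by
  classical
  induction s using Finset.induction_on with
  | empty => simp
  | insert a s has ih =>
    rw [sum_insert has, prod_insert has]
    have ha : 1 ≤ f a := hf a (mem_insert_self a s)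
    have hs : ∀ i ∈ s, 1 ≤ f i := fun i hi => hf i (mem_insert_of_mem hi)
    have hP : 1 ≤ ∏ i ∈ s, f i := by
      calc (1 : ℝ) = ∏ i ∈ s, (1 : ℝ) := by simp
        _ ≤ ∏ i ∈ s, f i := prod_le_prod (fun _ _ => zero_le_one) hs
    have ih' := ih hs
    nlinarith [mul_nonneg (sub_nonneg.2 ha) (sub_nonneg.2 hP)]

/-- **Lemma 5.1 of Lenstra–Pomerance (1992)** (from A. K. Lenstra, Indag. Math. 50 (1988) 443–454,
Lemma 4.1). Let `m, d, b` be positive integers with `d ≤ b`, `Λ ⊆ ℤ^m` a subgroup of (finite)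
index `h` with `(dℤ)^m ⊆ Λ`, and `𝒞 = c + Λ` a coset of `Λ`. Then
`#({1, 2, …, b}^m ∩ 𝒞) = (b^m / h) · e^ε` for some real `ε` with
`|ε| ≤ min{h - 1, m(d - 1)} / (b - d + 1)`.
(`m = 0` is allowed and trivial; `(dℤ)^m ⊆ Λ` is stated as `d·eᵢ ∈ Λ` for the unit vectors `eᵢ`;
the coset is written `{x : x - c ∈ Λ}`.) [cite: LenstraPomerance1992, Lemma 5.1] -/
theorem coset_box_count_eq_exp {m : ℕ} (Λ : AddSubgroup (Fin m → ℤ)) {d b : ℕ} (hd : 0 < d)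
    (hdb : d ≤ b) (hdΛ : ∀ i, Pi.single i (d : ℤ) ∈ Λ) (c : Fin m → ℤ) :
    ∃ ε : ℝ, |ε| ≤ min ((Λ.index : ℝ) - 1) (m * ((d : ℝ) - 1)) / ((b : ℝ) - d + 1) ∧
      ({x : Fin m → ℤ | (∀ i, 1 ≤ x i ∧ x i ≤ (b : ℤ)) ∧ x - c ∈ Λ}.ncard : ℝ)
        = (b : ℝ) ^ m / Λ.index * Real.exp ε := by
  obtain ⟨hs, hhs, hidx, hcount⟩ := exists_diag_box_count_bounds m Λ d hd hdΛ
  obtain ⟨hlow, hupp⟩ := hcount b c hdb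
  set N := ({x : Fin m → ℤ | (∀ i, 1 ≤ x i ∧ x i ≤ (b : ℤ)) ∧ x - c ∈ Λ}.ncard : ℝ) with hN
  have hd1 : (1 : ℝ) ≤ d := by exact_mod_cast hd
  have hdb' : (d : ℝ) ≤ b := by exact_mod_cast hdb
  have hb0 : (0 : ℝ) < b := by linarith
  have hhs1 : ∀ i, (1 : ℝ) ≤ hs i := fun i => by exact_mod_cast (hhs i).1
  have hhsd : ∀ i, (hs i : ℝ) ≤ d := fun i => by exact_mod_cast Nat.le_of_dvd hd (hhs i).2
  have hbd : (0 : ℝ) < (b : ℝ) - d + 1 := by linarith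
  have hidxR : (Λ.index : ℝ) = ∏ i, (hs i : ℝ) := by rw [hidx]; push_cast; rfl
  have hidx0 : (0 : ℝ) < Λ.index := by
    rw [hidxR]; exact prod_pos fun i _ => by linarith [hhs1 i]
  have hP₁pos : 0 < ∏ i, ((b : ℝ) - hs i + 1) / hs i :=
    prod_pos fun i _ => div_pos (by linarith [hhsd i]) (by linarith [hhs1 i])
  have hN0 : 0 < N := hP₁pos.trans_le hlow
  have hbm : (b : ℝ) ^ m = ∏ _i : Fin m, (b : ℝ) := by simp
  refine ⟨Real.log (N * Λ.index / (b : ℝ) ^ m), ?_, ?_⟩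
  swap
  · rw [Real.exp_log (by positivity)]
    field_simp
  -- the bound on `ε`
  set S := ∑ i, ((hs i : ℝ) - 1) with hS
  have hS1 : S ≤ (Λ.index : ℝ) - 1 := by
    rw [hidxR]; exact sum_sub_one_le_prod_sub_one _ _ fun i _ => hhs1 i
  have hS2 : S ≤ m * ((d : ℝ) - 1) := by
    calc S ≤ ∑ _i : Fin m, ((d : ℝ) - 1) := sum_le_sum fun i _ => by linarith [hhsd i]
      _ = m * ((d : ℝ) - 1) := by
          rw [Finset.sum_const, Finset.card_univ, Fintype.card_fin, nsmul_eq_mul]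
  have hSmin : S ≤ min ((Λ.index : ℝ) - 1) (m * ((d : ℝ) - 1)) := le_min hS1 hS2
  -- rewrite the quantity inside the logarithm as products over `i`
  have hquot : ∀ P : Fin m → ℝ, (∏ i, P i / hs i) * Λ.index / (b : ℝ) ^ m = ∏ i, P i / b := by
    intro P
    rw [hidxR, hbm, ← prod_mul_distrib, ← prod_div_distrib]
    refine prod_congr rfl fun i _ => ?_
    have : (hs i : ℝ) ≠ 0 := by linarith [hhs1 i]
    field_simp
  have hupper : Real.log (N * Λ.index / (b : ℝ) ^ m) ≤ S / ((b : ℝ) - d + 1) := by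
    calc Real.log (N * Λ.index / (b : ℝ) ^ m)
        ≤ Real.log ((∏ i, ((b : ℝ) + hs i - 1) / hs i) * Λ.index / (b : ℝ) ^ m) := by
          apply Real.log_le_log (by positivity)
          gcongr
      _ = ∑ i, Real.log (((b : ℝ) + hs i - 1) / b) := by
          rw [hquot, Real.log_prod]
          intro i _
          exact (div_pos (by linarith [hhs1 i]) hb0).ne'
      _ ≤ ∑ i, ((hs i : ℝ) - 1) / ((b : ℝ) - d + 1) := by
          refine sum_le_sum fun i _ => ?_
          calc Real.log (((b : ℝ) + hs i - 1) / b) ≤ ((b : ℝ) + hs i - 1) / b - 1 :=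
                Real.log_le_sub_one_of_pos (div_pos (by linarith [hhs1 i]) hb0)
            _ = ((hs i : ℝ) - 1) / b := by field_simp; ring
            _ ≤ ((hs i : ℝ) - 1) / ((b : ℝ) - d + 1) :=
                div_le_div_of_nonneg_left (by linarith [hhs1 i]) hbd (by linarith)
      _ = S / ((b : ℝ) - d + 1) := by rw [hS, sum_div]
  have hlower : -(S / ((b : ℝ) - d + 1)) ≤ Real.log (N * Λ.index / (b : ℝ) ^ m) := by
    calc -(S / ((b : ℝ) - d + 1)) = ∑ i, -(((hs i : ℝ) - 1) / ((b : ℝ) - d + 1)) := by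
          rw [hS, sum_div, sum_neg_distrib]
      _ ≤ ∑ i, Real.log (((b : ℝ) - hs i + 1) / b) := by
          refine sum_le_sum fun i _ => ?_
          have hpos : (0 : ℝ) < (b : ℝ) - hs i + 1 := by linarith [hhsd i]
          calc -(((hs i : ℝ) - 1) / ((b : ℝ) - d + 1)) ≤ -(((hs i : ℝ) - 1) / ((b : ℝ) - hs i + 1)) := by
                rw [neg_le_neg_iff]
                exact div_le_div_of_nonneg_left (by linarith [hhs1 i]) hbd (by linarith [hhsd i])
            _ = 1 - (((b : ℝ) - hs i + 1) / b)⁻¹ := by field_simp; ring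
            _ ≤ Real.log (((b : ℝ) - hs i + 1) / b) :=
                Real.one_sub_inv_le_log_of_pos (div_pos hpos hb0)
      _ = Real.log ((∏ i, ((b : ℝ) - hs i + 1) / hs i) * Λ.index / (b : ℝ) ^ m) := by
          rw [hquot, Real.log_prod]
          intro i _
          exact (div_pos (by linarith [hhsd i]) hb0).ne'
      _ ≤ Real.log (N * Λ.index / (b : ℝ) ^ m) := by
          apply Real.log_le_log (by positivity)
          gcongr
  have hSb : S / ((b : ℝ) - d + 1) ≤ min ((Λ.index : ℝ) - 1) (m * ((d : ℝ) - 1)) / ((b : ℝ) - d + 1) :=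
    div_le_div_of_nonneg_right hSmin hbd.le
  rw [abs_le]
  constructor <;> linarith

end LenstraPomerance
end Literature.Algebra.EuclideanLattices
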